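import Literature.NumberTheory.IwasawaTheory.Greenberg2006.CoinducedModuleDual
import Literature.NumberTheory.EllipticCurves.IwasawaAlgebraPseudoNullProofs
import Mathlib.RingTheory.Ideal.AssociatedPrime.Basic
import Mathlib.RingTheory.Ideal.KrullsHeightTheorem
import Mathlib.Algebra.Module.CharacterModule
import HarnessLib

/-!
# Greenberg 2006 §2 B–C: coreflexive discrete modules are divisible with divisible specialisations,
# and a two-element criterion for almost divisibility (no non-zero pseudo-null submodule in the dual)

Topic `NumberTheory/IwasawaTheory/Greenberg2006`; namespace
`Literature.NumberTheory.IwasawaTheory.Greenberg2006`; THEOREMS ONLY (no definition, no named fact,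
no `sorry`), in the dictionary (G2) of `Greenberg2016.SelmerGroupStructure` (`IsDualPairing`,
`IsCoreflexive`, `IsAlmostDivisible`, `HasNoPseudoNullSubmodule`; pseudo-null = the tree's
`Module.IsPseudoNull`, localisations at primes of height `≤ 1` vanish).

Source: R. Greenberg, *On the structure of certain Galois cohomology groups*, Doc. Math. Extra
Vol. Coates (2006) 335–391 [Greenberg2006], §2 B "Associated prime ideals and pseudo-nullity"
(pp. 349–351: "If `Q` is an associated prime ideal of `X`, then `X[Q] ≠ 0` … If `Q` has height
`≥ 2`, then `Q` contains infinitely many prime ideals `P` of height 1"; Prop. 2.4 "(a) `PA = A` for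
almost all `P ∈ Spec_{ht=1}(Λ)` … (b) The Pontryagin dual of `A` has no nonzero pseudo-null
`Λ`-submodules … (c) `A` is an almost divisible `Λ`-module") and §2 C "Reflexive and coreflexive
`Λ`-modules" (Prop. 2.6, p. 353: for reflexive `X` and a principal height-one prime `P = (π)`,
`X/PX` is a torsion-free `(Λ/P)`-module; Cor. 2.6.1, p. 354: for coreflexive `D`, `D[P]` is a
divisible `(Λ/P)`-module).

## What is here

* §1 (reflexive modules over a domain `Λ`, Mathlib `Module.IsReflexive`): a reflexive module is
  torsion-free (`noZeroSMulDivisors_of_isReflexive`) and **Prop. 2.6 in element form**: for a prime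
  element `π` and `μ ∉ (π)`, `μ x ∈ π X ⇒ x ∈ π X` (`exists_eq_smul_of_smul_eq_smul_of_isReflexive`;
  proof: `f ↦ f(x)/π` is a double-dual element).
* §2 (coreflexive discrete modules `D`, i.e. every Pontryagin dual is reflexive): `D` is divisible
  by every non-zero `π` (`IsCoreflexive.smul_surjective`) and **Cor. 2.6.1 in element form**: `D[π]`
  is `μ`-divisible for every `μ ∉ (π)` (`IsCoreflexive.exists_torsionBy_smul_eq`); the auxiliary
  `exists_smul_eq_of_forall_apply_torsionBy_eq_zero` (a character vanishing on `D[π]` is `π` times a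
  character, when `D` is `π`-divisible).
* §3 (the criterion, Prop. 2.4 (a) ⇒ (b) in a TWO-ELEMENT form that needs no "almost all `P`"): over
  a Noetherian factorial domain `Λ`, if `S = μS + πS` for every prime element `π` and every
  `μ ∉ (π)`, then every Pontryagin dual `X` of `S` has no non-zero pseudo-null submodule
  (`hasNoPseudoNullSubmodule_of_forall_exists_eq_add`, `isAlmostDivisible_of_forall_exists_eq_add`).
  Proof: a non-zero pseudo-null `N ≤ X` has an associated prime `Q = Ann(y)` (Mathlib
  `exists_le_isAssociatedPrime_of_isNoetherianRing`) not contained in any prime of height `≤ 1`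
  (`N_𝔭 = 0` there), hence `Q ∋ π` prime (factoriality) and `Q ∋ μ ∉ (π)`; `y` kills `μS + πS = S`,
  so `y = 0`. Inheritance: `IsAlmostDivisible.of_surjective`, `IsAlmostDivisible.range` (a quotient
  of an almost divisible module is almost divisible — the dual injects).

## What is NOT here
Not the converse (b) ⇒ (a) nor Cor. 2.5.1 (infinitely many height-one primes inside an ideal of
height `≥ 2`); nothing topological (duals are algebraic, as everywhere in the tree's dictionary);
nothing Galois-theoretic (the consumer is `Greenberg2016/LocalCohomologyAlmostDivisible.lean`,
Greenberg 2016 Prop. 4.2.2 = [Greenberg2006] Prop. 5.3).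
-/

noncomputable section

open scoped Classical
open Literature.NumberTheory.IwasawaTheory.Greenberg2016
open Literature.NumberTheory.EllipticCurves (Module.IsPseudoNull)

universe u

namespace Literature.NumberTheory.IwasawaTheory.Greenberg2006

/-! ### §1. Reflexive modules over a domain (Prop. 2.6) -/

section Reflexive

variable {Λ : Type u} [CommRing Λ] [IsDomain Λ] {X : Type u} [AddCommGroup X] [Module Λ X]

/-- A reflexive module over a domain is torsion-free (it embeds in a double dual
`Hom(Hom(X, Λ), Λ)`, which is torsion-free). [cite: Greenberg2006, §2 C (p. 352 L30–35, "reflexive … torsion-free")] -/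
theorem noZeroSMulDivisors_of_isReflexive [Module.IsReflexive Λ X] : NoZeroSMulDivisors Λ X := by
  refine ⟨fun {c x} h ↦ ?_⟩
  by_cases hc : c = 0
  · exact Or.inl hc
  refine Or.inr ((Module.bijective_dual_eval Λ X).1 ?_)
  rw [map_zero]
  ext f
  rw [Module.Dual.eval_apply, LinearMap.zero_apply]
  have h1 : c * f x = 0 := by rw [← smul_eq_mul, ← map_smul, h, map_zero]
  exact (mul_eq_zero.1 h1).resolve_left hc

/-- **Greenberg 2006 Prop. 2.6 in element form: for a reflexive `Λ`-module `X` (`Λ` a domain), a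
prime element `π` and `μ ∉ (π)`, if `μ x ∈ π X` then `x ∈ π X`** — i.e. `X/πX` has no
`μ`-torsion ("`X/PX` is a torsion-free `(Λ/P)`-module"). Proof: every `f(x)`, `f ∈ Hom(X, Λ)`, is
divisible by `π` (`μ f(x) = π f(y)`, `π` prime, `π ∤ μ`); `f ↦ f(x)/π` is a linear form on
`Hom(X, Λ)`, i.e. `eval(x')` for some `x'`, and then `x = π x'`.
[cite: Greenberg2006, Prop. 2.6 (§2 C, p. 353)] -/
theorem exists_eq_smul_of_smul_eq_smul_of_isReflexive [Module.IsReflexive Λ X] {π μ : Λ}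
    (hπ : Prime π) (hμ : ¬ π ∣ μ) {x y : X} (h : μ • x = π • y) : ∃ x' : X, x = π • x' := by
  have hdvd : ∀ f : Module.Dual Λ X, π ∣ f x := fun f ↦ by
    have h1 : μ * f x = π * f y := by
      rw [← smul_eq_mul, ← map_smul, h, map_smul, smul_eq_mul]
    exact (hπ.dvd_or_dvd ⟨f y, h1⟩).resolve_left hμ
  choose g hg using hdvd
  have hπ0 : π ≠ 0 := hπ.ne_zero
  let φ : Module.Dual Λ (Module.Dual Λ X) :=
    { toFun := g
      map_add' := fun f f' ↦ mul_left_cancel₀ hπ0 (by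
        rw [← hg, LinearMap.add_apply, hg, hg, mul_add])
      map_smul' := fun c f ↦ mul_left_cancel₀ hπ0 (by
        rw [← hg, LinearMap.smul_apply, hg, smul_eq_mul, RingHom.id_apply, smul_eq_mul]
        ring) }
  obtain ⟨x', hx'⟩ := (Module.bijective_dual_eval Λ X).2 φ
  refine ⟨x', (Module.bijective_dual_eval Λ X).1 ?_⟩
  ext f
  rw [Module.Dual.eval_apply, Module.Dual.eval_apply, map_smul, smul_eq_mul, hg f]
  congr 1
  have := congrArg (fun ψ : Module.Dual Λ (Module.Dual Λ X) ↦ ψ f) hx'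
  simp only [Module.Dual.eval_apply] at this
  rw [this]
  rfl

end Reflexive

/-! ### §2. Coreflexive discrete modules: divisibility of `D` and of `D[π]` (Cor. 2.6.1) -/

section Coreflexive

variable {Λ : Type u} [CommRing Λ] {D : Type u} [AddCommGroup D] [Module Λ D]

/-- If `D` is `π`-divisible, a character of `D` vanishing on `D[π]` is `π` times a character
(`ψ = ψ' ∘ (π·)` with `ψ'(πd) := ψ(d)`, well defined because two `π`-th roots differ by an element
of `D[π]`). [cite: Greenberg2006, §2 C (Cor. 2.6.1, p. 354)] -/
theorem exists_smul_eq_of_forall_apply_torsionBy_eq_zero {π : Λ} (hsurj : ∀ d : D, ∃ d', π • d' = d)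
    (ψ : CharacterModule D) (hψ : ∀ d : D, π • d = 0 → ψ d = 0) :
    ∃ ψ' : CharacterModule D, π • ψ' = ψ := by
  choose g hg using hsurj
  have hT : ∀ a b : D, π • a = π • b → ψ a = ψ b := fun a b hab ↦ by
    rw [← sub_eq_zero, ← map_sub]
    exact hψ _ (by rw [smul_sub, hab, sub_self])
  let ψ' : CharacterModule D := AddMonoidHom.mk' (fun d ↦ ψ (g d)) (fun a b ↦ by
    rw [← map_add]
    exact hT _ _ (by rw [hg, smul_add, hg, hg]))
  refine ⟨ψ', ?_⟩
  ext d
  rw [CharacterModule.smul_apply]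
  change ψ (g (π • d)) = ψ d
  exact hT _ _ (by rw [hg])

variable [IsDomain Λ]

/-- **A coreflexive discrete module is divisible by every non-zero scalar** (its character module
is reflexive, hence torsion-free; a non-zero character of `D/πD` would be a `π`-torsion character
of `D`). [cite: Greenberg2006, §2 C (p. 353 L1–6 "coreflexive … divisible")] -/
theorem _root_.Literature.NumberTheory.IwasawaTheory.Greenberg2016.IsCoreflexive.smul_surjective
    (hD : IsCoreflexive Λ D) {π : Λ} (hπ : π ≠ 0) (d : D) : ∃ d' : D, π • d' = d := by
  haveI := hD _ (AddMonoidHom.id (CharacterModule D)) (isDualPairing_characterModule Λ D)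
  haveI := noZeroSMulDivisors_of_isReflexive (Λ := Λ) (X := CharacterModule D)
  refine Classical.by_contradiction fun h ↦ ?_
  let W : Submodule Λ D := LinearMap.range (DistribSMul.toLinearMap Λ D π)
  have hne : W.mkQ d ≠ 0 := by
    rw [Ne, Submodule.mkQ_apply, Submodule.Quotient.mk_eq_zero]
    rintro ⟨d', hd'⟩
    exact h ⟨d', hd'⟩
  obtain ⟨χ₀, hχ₀⟩ := CharacterModule.exists_character_apply_ne_zero_of_ne_zero hne
  let χ : CharacterModule D := χ₀.comp W.mkQ.toAddMonoidHom
  have hχ : π • χ = 0 := by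
    ext s
    rw [CharacterModule.smul_apply]
    change χ₀ (W.mkQ (π • s)) = 0
    have hmem : π • s ∈ W := ⟨s, rfl⟩
    rw [Submodule.mkQ_apply, (Submodule.Quotient.mk_eq_zero W).2 hmem, map_zero]
  have hχ0 : χ = 0 := (smul_eq_zero.1 hχ).resolve_left hπ
  exact hχ₀ (show χ d = 0 by rw [hχ0]; rfl)

/-- **Greenberg 2006 Cor. 2.6.1 in element form: for a coreflexive discrete module `D`, a prime
element `π` and `μ ∉ (π)`, the submodule `D[π]` is `μ`-divisible** ("`D[P]` is a divisible
`(Λ/P)`-module"). Proof: a character of `D[π]` non-zero at `d` and vanishing on `μ·D[π]` extends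
to a character `χ` of `D` (`ℚ/ℤ` is injective); `μχ` vanishes on `D[π]`, so `μχ = πψ'`
(`exists_smul_eq_of_forall_apply_torsionBy_eq_zero`), so `χ ∈ π·Hom(D, ℚ/ℤ)` by Prop. 2.6
(`exists_eq_smul_of_smul_eq_smul_of_isReflexive`), so `χ` vanishes on `D[π] ∋ d` — contradiction.
[cite: Greenberg2006, Cor. 2.6.1 (§2 C, p. 354)] -/
theorem _root_.Literature.NumberTheory.IwasawaTheory.Greenberg2016.IsCoreflexive.exists_torsionBy_smul_eq
    (hD : IsCoreflexive Λ D) {π μ : Λ} (hπ : Prime π) (hμ : ¬ π ∣ μ) {d : D} (hd : π • d = 0) :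
    ∃ d' : D, π • d' = 0 ∧ μ • d' = d := by
  haveI := hD _ (AddMonoidHom.id (CharacterModule D)) (isDualPairing_characterModule Λ D)
  have hsurj := hD.smul_surjective hπ.ne_zero
  refine Classical.by_contradiction fun h ↦ ?_
  set T : Submodule Λ D := Submodule.torsionBy Λ D π with hTdef
  let t : T := ⟨d, (Submodule.mem_torsionBy_iff π d).2 hd⟩
  let W : Submodule Λ T := LinearMap.range (DistribSMul.toLinearMap Λ T μ)
  have ht : W.mkQ t ≠ 0 := by
    rw [Ne, Submodule.mkQ_apply, Submodule.Quotient.mk_eq_zero]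
    rintro ⟨t', ht'⟩
    refine h ⟨t', (Submodule.mem_torsionBy_iff π (t' : D)).1 t'.2, ?_⟩
    have := congrArg Subtype.val ht'
    simpa using this
  obtain ⟨χ₀, hχ₀⟩ := CharacterModule.exists_character_apply_ne_zero_of_ne_zero ht
  let χ₁ : CharacterModule T := χ₀.comp W.mkQ.toAddMonoidHom
  obtain ⟨χ, hχ⟩ :=
    CharacterModule.dual_surjective_of_injective T.subtype T.injective_subtype χ₁
  have hχT : ∀ t' : T, χ (t' : D) = χ₁ t' := fun t' ↦ by
    rw [← hχ]
    rfl
  have hμχ : ∀ d' : D, π • d' = 0 → (μ • χ) d' = 0 := fun d' hd' ↦ by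
    rw [CharacterModule.smul_apply]
    have h1 : μ • d' = ((μ • (⟨d', (Submodule.mem_torsionBy_iff π d').2 hd'⟩ : T) : T) : D) := rfl
    rw [h1, hχT]
    change χ₀ (W.mkQ (μ • _)) = 0
    have hmem : μ • (⟨d', (Submodule.mem_torsionBy_iff π d').2 hd'⟩ : T) ∈ W := ⟨_, rfl⟩
    rw [Submodule.mkQ_apply, (Submodule.Quotient.mk_eq_zero W).2 hmem, map_zero]
  obtain ⟨ψ', hψ'⟩ := exists_smul_eq_of_forall_apply_torsionBy_eq_zero hsurj (μ • χ) hμχ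
  obtain ⟨χ', hχ'⟩ := exists_eq_smul_of_smul_eq_smul_of_isReflexive hπ hμ hψ'.symm
  apply hχ₀
  change χ₁ t = 0
  rw [← hχT, hχ', CharacterModule.smul_apply]
  change χ' (π • d) = 0
  rw [hd, map_zero]

end Coreflexive

/-! ### §3. The two-element criterion for "no non-zero pseudo-null submodule" (Prop. 2.4 (a) ⇒ (b)) -/

section Criterion

variable {Λ : Type u} [CommRing Λ] [IsDomain Λ] [IsNoetherianRing Λ] [UniqueFactorizationMonoid Λ]
  {S : Type u} [AddCommGroup S] [Module Λ S]

/-- **Greenberg 2006 Prop. 2.4 (a) ⇒ (b), two-element form.** Over a Noetherian factorial domain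
`Λ`: if `S = μS + πS` for every prime element `π` and every `μ ∉ (π)`, then every Pontryagin dual
`X` of `S` (any `IsDualPairing` datum, values in any group) has no non-zero pseudo-null
`Λ`-submodule. Proof: a non-zero pseudo-null `N ≤ X` has an associated prime `Q = Ann(y)`, `y ≠ 0`
("If `Q` is an associated prime ideal of `X`, then `X[Q] ≠ 0`"); `N_𝔭 = 0` for `ht 𝔭 ≤ 1` gives an
element of `Q` outside every such `𝔭`, so `Q ≠ 0` contains a prime element `π` (factoriality) and
some `μ ∉ (π)` (`ht (π) ≤ 1`, Krull); `y` is killed by `π` and `μ`, hence pairs trivially with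
`μS + πS = S`, so `y = 0`. [cite: Greenberg2006, §2 B (p. 350 L25–31) and Prop. 2.4 (pp. 350–351)] -/
theorem hasNoPseudoNullSubmodule_of_forall_exists_eq_add {C : Type*} [AddCommGroup C]
    {X : Type u} [AddCommGroup X] [Module Λ X] {toDual : X →+ (S →+ C)}
    (hX : IsDualPairing Λ S toDual)
    (hS : ∀ π μ : Λ, Prime π → ¬ π ∣ μ → ∀ s : S, ∃ a b : S, s = μ • a + π • b) :
    HasNoPseudoNullSubmodule Λ X := by
  intro N hN
  by_contra hne
  obtain ⟨n, hnN, hn0⟩ := (Submodule.ne_bot_iff N).1 hne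
  have hy₀ : (⟨n, hnN⟩ : N) ≠ 0 := fun h ↦ hn0 (congrArg Subtype.val h)
  obtain ⟨P, hP, -⟩ := exists_le_isAssociatedPrime_of_isNoetherianRing Λ (⟨n, hnN⟩ : N) hy₀
  obtain ⟨hPprime, y, hPy⟩ := isAssociatedPrime_iff.1 hP
  have hmemP : ∀ r : Λ, r ∈ P ↔ r • y = 0 := fun r ↦ by
    rw [hPy, Submodule.mem_colon_singleton, Submodule.mem_bot]
  have hy : y ≠ 0 := by
    rintro rfl
    refine hPprime.ne_top ((Ideal.eq_top_iff_one P).2 ?_)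
    rw [hmemP, smul_zero]
  -- pseudo-nullity: every prime of height `≤ 1` misses some element of `P`
  have hkey : ∀ 𝔭 : PrimeSpectrum Λ, 𝔭.asIdeal.height ≤ 1 → ∃ s ∉ 𝔭.asIdeal, s ∈ P :=
    fun 𝔭 h𝔭 ↦ by
    have hsub := hN 𝔭 h𝔭
    rw [LocalizedModule.subsingleton_iff] at hsub
    obtain ⟨s, hs, hsy⟩ := hsub y
    exact ⟨s, hs, (hmemP s).2 hsy⟩
  have hPne : P ≠ ⊥ := by
    intro hP0
    obtain ⟨s, hs, hsP⟩ := hkey ⟨⊥, Ideal.isPrime_bot⟩ (by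
      rw [Ideal.height_bot]; exact zero_le_one)
    rw [hP0] at hsP
    exact hs hsP
  obtain ⟨π, hπP, hπ⟩ := hPprime.exists_mem_prime_of_ne_bot hPne
  have hspan : (Ideal.span {π}).IsPrime := (Ideal.span_singleton_prime hπ.ne_zero).2 hπ
  haveI := hspan
  obtain ⟨μ, hμ, hμP⟩ := hkey ⟨Ideal.span {π}, hspan⟩
    (Ideal.height_le_one_of_isPrincipal_of_mem_minimalPrimes (Ideal.span {π}) (Ideal.span {π})
      (by rw [Ideal.minimalPrimes_eq_subsingleton_self]; exact Set.mem_singleton _))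
  have hμ' : ¬ π ∣ μ := fun h ↦ hμ (Ideal.mem_span_singleton.2 h)
  have hπy : π • (y : X) = 0 := by rw [← Submodule.coe_smul, (hmemP π).1 hπP, Submodule.coe_zero]
  have hμy : μ • (y : X) = 0 := by rw [← Submodule.coe_smul, (hmemP μ).1 hμP, Submodule.coe_zero]
  refine hy (Subtype.ext (hX.injective ?_))
  rw [Submodule.coe_zero, map_zero]
  ext s
  obtain ⟨a, b, rfl⟩ := hS π μ hπ hμ' s
  rw [map_add, ← hX.map_smul, ← hX.map_smul, hπy, hμy, map_zero]
  simp

/-- The criterion in `IsAlmostDivisible` form (Greenberg's fifth bullet, every dual datum).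
[cite: Greenberg2006, Prop. 2.4 (§2 B, pp. 350–351)] -/
theorem isAlmostDivisible_of_forall_exists_eq_add
    (hS : ∀ π μ : Λ, Prime π → ¬ π ∣ μ → ∀ s : S, ∃ a b : S, s = μ • a + π • b) :
    IsAlmostDivisible Λ S :=
  fun _ _ _ _ hX ↦ hasNoPseudoNullSubmodule_of_forall_exists_eq_add hX hS

end Criterion

/-! ### §4. Inheritance: quotients and images of almost divisible modules -/

section Inheritance

variable {Λ : Type u} [CommRing Λ] {S : Type u} [AddCommGroup S] [Module Λ S]
  {S' : Type u} [AddCommGroup S'] [Module Λ S']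

/-- **A quotient of an almost divisible module is almost divisible**: a Pontryagin dual of the
quotient injects `Λ`-linearly into the character module of `S` (`CharacterModule.dual` of a
surjection is injective), and a pseudo-null submodule maps onto a pseudo-null submodule.
[cite: Greenberg2006, Prop. 2.4 (§2 B, pp. 350–351)] [cite: Greenberg2016Selmer, Prop. 4.2.2 (§4.2 p. 20 L7–8 "Hence the image … is also almost `Λ`-divisible")] -/
theorem _root_.Literature.NumberTheory.IwasawaTheory.Greenberg2016.IsAlmostDivisible.of_surjective
    (h : IsAlmostDivisible Λ S) (f : S →ₗ[Λ] S') (hf : Function.Surjective f) :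
    IsAlmostDivisible Λ S' := by
  intro X' _ _ toDual' hX' N hN
  let e' := hX'.linearEquiv (isDualPairing_characterModule Λ S')
  let g : X' →ₗ[Λ] CharacterModule S := (CharacterModule.dual f) ∘ₗ e'.toLinearMap
  have hg : Function.Injective g :=
    (CharacterModule.dual_injective_of_surjective f hf).comp e'.injective
  have hNg : Module.IsPseudoNull Λ (N.map g) :=
    hN.of_linearEquiv (Submodule.equivMapOfInjective g hg N)
  have h0 := h _ (AddMonoidHom.id (CharacterModule S)) (isDualPairing_characterModule Λ S)
    (N.map g) hNg
  rw [Submodule.eq_bot_iff] at h0 ⊢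
  intro x hx
  exact hg (by rw [map_zero]; exact h0 _ (Submodule.mem_map_of_mem hx))

/-- The range of a linear map out of an almost divisible module is almost divisible.
[cite: Greenberg2016Selmer, Prop. 4.2.2 (§4.2 p. 20 L7–8)] -/
theorem _root_.Literature.NumberTheory.IwasawaTheory.Greenberg2016.IsAlmostDivisible.range
    (h : IsAlmostDivisible Λ S) (f : S →ₗ[Λ] S') : IsAlmostDivisible Λ (LinearMap.range f) :=
  h.of_surjective f.rangeRestrict f.surjective_rangeRestrict

end Inheritance

end Literature.NumberTheory.IwasawaTheory.Greenberg2006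

end
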